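import Summits.ValiantsHypothesis.ValiantsHypothesis.Theorems.SymPencilPerFourPeeledCornerGenSwapFrameless
import Summits.ValiantsHypothesis.ValiantsHypothesis.Theorems.SymPencilPerFourPeeledTwoPencilFramelessFlip
import Summits.ValiantsHypothesis.ValiantsHypothesis.Theorems.SymPencilPerFourInnerRankOfPeeled

/-!
# Route `SymPencil` — inner rank of the `2 | 2` row split of `per_4`: the PEELED case at eleven
# squares, `IR11` and cell `(8,8,11)` of `m = 28`, GIVEN the coverage theorem (`--supports`
# stmt-ValiantsHypothesis-5674 `SdcSuperquadratic`; (8,8) column; memo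
# `NOTE-p8g15-5674-R2-two-pencil.md` §9.7 + the corner files `…CornerGenSwap*`; rung currency only)

The (8,8,11) programme is: a reduced peeled family on `≤ 11` squares has both correction
matrices `Ψ, Ψ′` (and their transposes) FRAMELESS
(`…TwoPencilFramelessFlip.exists_frameless_quadruple_of_peeled`, val-lit-p8 g15); COVERAGE
(val-lit-p8 g16, in progress): a frameless `Ψ` with frameless `Ψᵀ` is a generalized swap
`aᵀΨx = u a_i x_j + w a_j x_i`; CORNER (val-lit-p6 g16/g17, landed):
`…CornerGenSwapFrameless.false_of_frameless_genswap_pair`.  This file composes the three with the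
coverage theorem as an explicit HYPOTHESIS `hcov` (stated exactly as announced on the cell bus,
2026-08-29 01:57Z, C5 `genSwap_of_frameless`), in the pattern of
`…TwoPencilReduction.IR11_of_frames` / `…PeeledTenHR2`:

* `false_of_peeled_le_eleven_of_coverage` — no reduced peeled family on `≤ 11` squares;
* `HR2_eleven_of_coverage` — the binder `HR2` of `…InnerRankOfPeeled.IR_of_peeled` at `d = 11`;
* `IR11_of_coverage` — the `2 | 2` inner-rank identity of `per_4` is impossible on `11` squares;
* `false_of_rank_eight_le_twentyEight_of_coverage` — cell `(8,8,11)` of `m = 28`.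

When the coverage theorem lands, each `_of_coverage` theorem is discharged by one application.
Honest framing: CONDITIONAL on `hcov` (an explicit hypothesis, not a named fact); unlike the
refuted `hframes` of `IR11_of_frames` (crit-5 g4, `…/Negative/TwoPencilHFramesFalse`), `hcov` asks
frames only OFF the generalized swaps, which is the announced coverage statement — but it is NOT
proved here; (8,8,11) stays OPEN; `28 ≤ sdc(per_4) ≤ 29` of record, the crux `SdcSuperquadratic`
and `VP ≠ VNP` untouched.  No definitions, no named facts. [folklore]
-/

noncomputable section

-- single-conjunct layout: Sub = Summit, duplicated namespace component intended
set_option linter.dupNamespace false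

namespace Summit.ValiantsHypothesis.ValiantsHypothesis.Theorems.SymPencilPerFourPeeledElevenOfCoverage

open Matrix Finset Module MvPolynomial
open Literature.Computability.AlgebraicComplexity
open Summit.ValiantsHypothesis.ValiantsHypothesis.Theorems.SymPencilPerFourPeeledCornerGenSwapFrameless
open Summit.ValiantsHypothesis.ValiantsHypothesis.Theorems.SymPencilPerFourPeeledTwoPencilFramelessFlip
open Summit.ValiantsHypothesis.ValiantsHypothesis.Theorems.SymPencilPerFourInnerRankOfPeeled

universe v

/-- **No reduced peeled family on `≤ 11` squares, GIVEN coverage.** [folklore] -/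
theorem false_of_peeled_le_eleven_of_coverage {K : Type*} [Field K] [CharZero K]
    (hcov : ∀ Φ : Matrix (Fin 4) (Fin 4) K,
      (¬ ∃ (a₀ a₁ y₀ y₁ : Fin 4 → K) (P₀₀ P₁₀ P₀₁ P₁₁ W₀ : Matrix (Fin 4) (Fin 4) K)
        (v : Fin 4 → Fin 4 → K) (s : Fin 4 → K) (W : Matrix (Fin 4) (Fin 4) K),
        a₀ ⬝ᵥ Φ *ᵥ y₀ = 0 ∧ a₀ ⬝ᵥ Φ *ᵥ y₁ = 0 ∧ a₁ ⬝ᵥ Φ *ᵥ y₀ = 0 ∧ a₁ ⬝ᵥ Φ *ᵥ y₁ = 0 ∧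
        (∀ b l, P₀₀ b l = (Matrix.of ![a₀, Pi.single b 1, y₀, Pi.single l 1]).permanent) ∧
        (∀ b l, P₁₀ b l = (Matrix.of ![a₀, Pi.single b 1, y₁, Pi.single l 1]).permanent) ∧
        (∀ b l, P₀₁ b l = (Matrix.of ![a₁, Pi.single b 1, y₀, Pi.single l 1]).permanent) ∧
        (∀ b l, P₁₁ b l = (Matrix.of ![a₁, Pi.single b 1, y₁, Pi.single l 1]).permanent) ∧
        W₀ * P₀₀ = 1 ∧ (∀ j, P₁₀ *ᵥ v j = s j • P₀₀ *ᵥ v j) ∧ (∀ i j, i ≠ j → s i ≠ s j) ∧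
        W * Matrix.of v = 1 ∧ P₁₁ - P₁₀ * W₀ * P₀₁ ≠ 0) →
      (¬ ∃ (a₀ a₁ y₀ y₁ : Fin 4 → K) (P₀₀ P₁₀ P₀₁ P₁₁ W₀ : Matrix (Fin 4) (Fin 4) K)
        (v : Fin 4 → Fin 4 → K) (s : Fin 4 → K) (W : Matrix (Fin 4) (Fin 4) K),
        a₀ ⬝ᵥ Φᵀ *ᵥ y₀ = 0 ∧ a₀ ⬝ᵥ Φᵀ *ᵥ y₁ = 0 ∧ a₁ ⬝ᵥ Φᵀ *ᵥ y₀ = 0 ∧ a₁ ⬝ᵥ Φᵀ *ᵥ y₁ = 0 ∧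
        (∀ b l, P₀₀ b l = (Matrix.of ![a₀, Pi.single b 1, y₀, Pi.single l 1]).permanent) ∧
        (∀ b l, P₁₀ b l = (Matrix.of ![a₀, Pi.single b 1, y₁, Pi.single l 1]).permanent) ∧
        (∀ b l, P₀₁ b l = (Matrix.of ![a₁, Pi.single b 1, y₀, Pi.single l 1]).permanent) ∧
        (∀ b l, P₁₁ b l = (Matrix.of ![a₁, Pi.single b 1, y₁, Pi.single l 1]).permanent) ∧
        W₀ * P₀₀ = 1 ∧ (∀ j, P₁₀ *ᵥ v j = s j • P₀₀ *ᵥ v j) ∧ (∀ i j, i ≠ j → s i ≠ s j) ∧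
        W * Matrix.of v = 1 ∧ P₁₁ - P₁₀ * W₀ * P₀₁ ≠ 0) →
      ∃ (i j : Fin 4) (u w : K), i ≠ j ∧ u ≠ 0 ∧ w ≠ 0 ∧
        ∀ a x : Fin 4 → K, a ⬝ᵥ Φ *ᵥ x = u * a i * x j + w * a j * x i)
    {κ : Type v} [Fintype κ] [DecidableEq κ] (hκ : Fintype.card κ ≤ 11) (c : κ → K)
    (hc : ∀ r, c r ≠ 0)
    (t : κ → (((Fin 4 → K) × (Fin 4 → K)) →ₗ[K] ((Fin 4 → K) × (Fin 4 → K)) →ₗ[K] K))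
    (hJ : ∀ a b y₂ y₃ : Fin 4 → K,
      ∑ r, c r * (t r (a, b) (y₂, y₃)) ^ 2 = (Matrix.of ![a, b, y₂, y₃]).permanent)
    (v₀ v₀' : κ → K) (hv₀ : ∀ (a x : Fin 4 → K), ∃ s : K, (fun r => t r (a, 0) (x, 0)) = s • v₀)
    (hv₀' : ∀ (b x : Fin 4 → K), ∃ s : K, (fun r => t r (0, b) (0, x)) = s • v₀')
    (hpeel : ∃ a b y z : Fin 4 → K, ∑ r, c r * t r (a, 0) (y, 0) * t r (0, b) (0, z) ≠ 0) :
    False := by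
  obtain ⟨Ψ, Ψ', hΨ, hΨ', n1, n2, n3, n4⟩ :=
    exists_frameless_quadruple_of_peeled hκ c t hJ v₀ v₀' hv₀ hv₀' hpeel
  obtain ⟨i, j, u₀, w₀, hij, hu₀, hw₀, hf⟩ := hcov Ψ n1 n2
  obtain ⟨k, l, u₁, w₁, hkl, hu₁, hw₁, hf'⟩ := hcov Ψ' n3 n4
  exact false_of_frameless_genswap_pair hκ c hc t hJ v₀ v₀' hv₀ hv₀' hpeel Ψ Ψ' hΨ hΨ' n1 n3 i j
    hij u₀ w₀ hu₀ hw₀ hf k l hkl u₁ w₁ hu₁ hw₁ hf'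

/-- **`HR2` at `d = 11`, GIVEN coverage** — the binder of `…InnerRankOfPeeled.IR_of_peeled`,
verbatim. [folklore] -/
theorem HR2_eleven_of_coverage (K : Type*) [Field K] [CharZero K]
    (hcov : ∀ Φ : Matrix (Fin 4) (Fin 4) K,
      (¬ ∃ (a₀ a₁ y₀ y₁ : Fin 4 → K) (P₀₀ P₁₀ P₀₁ P₁₁ W₀ : Matrix (Fin 4) (Fin 4) K)
        (v : Fin 4 → Fin 4 → K) (s : Fin 4 → K) (W : Matrix (Fin 4) (Fin 4) K),
        a₀ ⬝ᵥ Φ *ᵥ y₀ = 0 ∧ a₀ ⬝ᵥ Φ *ᵥ y₁ = 0 ∧ a₁ ⬝ᵥ Φ *ᵥ y₀ = 0 ∧ a₁ ⬝ᵥ Φ *ᵥ y₁ = 0 ∧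
        (∀ b l, P₀₀ b l = (Matrix.of ![a₀, Pi.single b 1, y₀, Pi.single l 1]).permanent) ∧
        (∀ b l, P₁₀ b l = (Matrix.of ![a₀, Pi.single b 1, y₁, Pi.single l 1]).permanent) ∧
        (∀ b l, P₀₁ b l = (Matrix.of ![a₁, Pi.single b 1, y₀, Pi.single l 1]).permanent) ∧
        (∀ b l, P₁₁ b l = (Matrix.of ![a₁, Pi.single b 1, y₁, Pi.single l 1]).permanent) ∧
        W₀ * P₀₀ = 1 ∧ (∀ j, P₁₀ *ᵥ v j = s j • P₀₀ *ᵥ v j) ∧ (∀ i j, i ≠ j → s i ≠ s j) ∧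
        W * Matrix.of v = 1 ∧ P₁₁ - P₁₀ * W₀ * P₀₁ ≠ 0) →
      (¬ ∃ (a₀ a₁ y₀ y₁ : Fin 4 → K) (P₀₀ P₁₀ P₀₁ P₁₁ W₀ : Matrix (Fin 4) (Fin 4) K)
        (v : Fin 4 → Fin 4 → K) (s : Fin 4 → K) (W : Matrix (Fin 4) (Fin 4) K),
        a₀ ⬝ᵥ Φᵀ *ᵥ y₀ = 0 ∧ a₀ ⬝ᵥ Φᵀ *ᵥ y₁ = 0 ∧ a₁ ⬝ᵥ Φᵀ *ᵥ y₀ = 0 ∧ a₁ ⬝ᵥ Φᵀ *ᵥ y₁ = 0 ∧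
        (∀ b l, P₀₀ b l = (Matrix.of ![a₀, Pi.single b 1, y₀, Pi.single l 1]).permanent) ∧
        (∀ b l, P₁₀ b l = (Matrix.of ![a₀, Pi.single b 1, y₁, Pi.single l 1]).permanent) ∧
        (∀ b l, P₀₁ b l = (Matrix.of ![a₁, Pi.single b 1, y₀, Pi.single l 1]).permanent) ∧
        (∀ b l, P₁₁ b l = (Matrix.of ![a₁, Pi.single b 1, y₁, Pi.single l 1]).permanent) ∧
        W₀ * P₀₀ = 1 ∧ (∀ j, P₁₀ *ᵥ v j = s j • P₀₀ *ᵥ v j) ∧ (∀ i j, i ≠ j → s i ≠ s j) ∧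
        W * Matrix.of v = 1 ∧ P₁₁ - P₁₀ * W₀ * P₀₁ ≠ 0) →
      ∃ (i j : Fin 4) (u w : K), i ≠ j ∧ u ≠ 0 ∧ w ≠ 0 ∧
        ∀ a x : Fin 4 → K, a ⬝ᵥ Φ *ᵥ x = u * a i * x j + w * a j * x i) :
    ∀ (κ : Type) [Fintype κ] [DecidableEq κ], Fintype.card κ ≤ 11 →
      ∀ (c : κ → K), (∀ r, c r ≠ 0) →
      ∀ (t : κ → (((Fin 4 → K) × (Fin 4 → K)) →ₗ[K] ((Fin 4 → K) × (Fin 4 → K)) →ₗ[K] K)),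
      (∀ a b y₂ y₃ : Fin 4 → K,
        ∑ r, c r * (t r (a, b) (y₂, y₃)) ^ 2 = (Matrix.of ![a, b, y₂, y₃]).permanent) →
      ∀ (v₀ v₀' : κ → K),
      (∀ (a x : Fin 4 → K), ∃ s : K, (fun r => t r (a, 0) (x, 0)) = s • v₀) →
      (∀ (b x : Fin 4 → K), ∃ s : K, (fun r => t r (0, b) (0, x)) = s • v₀') →
      (∀ a b y₂ y₃ : Fin 4 → K,
        ∑ r, c r * (t r (0, b) (y₂, 0) + t r (a, 0) (0, y₃)) ^ 2 =
          (Matrix.of ![a, b, y₂, y₃]).permanent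
            - 2 * ∑ r, c r * t r (a, 0) (y₂, 0) * t r (0, b) (0, y₃)) →
      (∃ a b y z : Fin 4 → K, ∑ r, c r * t r (a, 0) (y, 0) * t r (0, b) (0, z) ≠ 0) → False :=
  fun _ _ _ hκ c hc t hJ v₀ v₀' hv₀ hv₀' _ hpeel =>
    false_of_peeled_le_eleven_of_coverage hcov hκ c hc t hJ v₀ v₀' hv₀ hv₀' hpeel

/-- **IR11, GIVEN coverage.**  The `2 | 2` inner-rank identity of `per_4` has no solution on
eleven squares. [folklore] -/
theorem IR11_of_coverage (K : Type*) [Field K] [CharZero K]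
    (hcov : ∀ Φ : Matrix (Fin 4) (Fin 4) K,
      (¬ ∃ (a₀ a₁ y₀ y₁ : Fin 4 → K) (P₀₀ P₁₀ P₀₁ P₁₁ W₀ : Matrix (Fin 4) (Fin 4) K)
        (v : Fin 4 → Fin 4 → K) (s : Fin 4 → K) (W : Matrix (Fin 4) (Fin 4) K),
        a₀ ⬝ᵥ Φ *ᵥ y₀ = 0 ∧ a₀ ⬝ᵥ Φ *ᵥ y₁ = 0 ∧ a₁ ⬝ᵥ Φ *ᵥ y₀ = 0 ∧ a₁ ⬝ᵥ Φ *ᵥ y₁ = 0 ∧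
        (∀ b l, P₀₀ b l = (Matrix.of ![a₀, Pi.single b 1, y₀, Pi.single l 1]).permanent) ∧
        (∀ b l, P₁₀ b l = (Matrix.of ![a₀, Pi.single b 1, y₁, Pi.single l 1]).permanent) ∧
        (∀ b l, P₀₁ b l = (Matrix.of ![a₁, Pi.single b 1, y₀, Pi.single l 1]).permanent) ∧
        (∀ b l, P₁₁ b l = (Matrix.of ![a₁, Pi.single b 1, y₁, Pi.single l 1]).permanent) ∧
        W₀ * P₀₀ = 1 ∧ (∀ j, P₁₀ *ᵥ v j = s j • P₀₀ *ᵥ v j) ∧ (∀ i j, i ≠ j → s i ≠ s j) ∧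
        W * Matrix.of v = 1 ∧ P₁₁ - P₁₀ * W₀ * P₀₁ ≠ 0) →
      (¬ ∃ (a₀ a₁ y₀ y₁ : Fin 4 → K) (P₀₀ P₁₀ P₀₁ P₁₁ W₀ : Matrix (Fin 4) (Fin 4) K)
        (v : Fin 4 → Fin 4 → K) (s : Fin 4 → K) (W : Matrix (Fin 4) (Fin 4) K),
        a₀ ⬝ᵥ Φᵀ *ᵥ y₀ = 0 ∧ a₀ ⬝ᵥ Φᵀ *ᵥ y₁ = 0 ∧ a₁ ⬝ᵥ Φᵀ *ᵥ y₀ = 0 ∧ a₁ ⬝ᵥ Φᵀ *ᵥ y₁ = 0 ∧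
        (∀ b l, P₀₀ b l = (Matrix.of ![a₀, Pi.single b 1, y₀, Pi.single l 1]).permanent) ∧
        (∀ b l, P₁₀ b l = (Matrix.of ![a₀, Pi.single b 1, y₁, Pi.single l 1]).permanent) ∧
        (∀ b l, P₀₁ b l = (Matrix.of ![a₁, Pi.single b 1, y₀, Pi.single l 1]).permanent) ∧
        (∀ b l, P₁₁ b l = (Matrix.of ![a₁, Pi.single b 1, y₁, Pi.single l 1]).permanent) ∧
        W₀ * P₀₀ = 1 ∧ (∀ j, P₁₀ *ᵥ v j = s j • P₀₀ *ᵥ v j) ∧ (∀ i j, i ≠ j → s i ≠ s j) ∧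
        W * Matrix.of v = 1 ∧ P₁₁ - P₁₀ * W₀ * P₀₁ ≠ 0) →
      ∃ (i j : Fin 4) (u w : K), i ≠ j ∧ u ≠ 0 ∧ w ≠ 0 ∧
        ∀ a x : Fin 4 → K, a ⬝ᵥ Φ *ᵥ x = u * a i * x j + w * a j * x i) :
    ∀ (c : Fin 11 → K)
      (t : Fin 11 → (((Fin 4 → K) × (Fin 4 → K)) →ₗ[K] ((Fin 4 → K) × (Fin 4 → K)) →ₗ[K] K)),
      ¬ ∀ a b y₂ y₃ : Fin 4 → K,
        ∑ r, c r * (t r (a, b) (y₂, y₃)) ^ 2 = (Matrix.of ![a, b, y₂, y₃]).permanent :=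
  IR_of_peeled le_rfl (HR2_eleven_of_coverage K hcov)

/-- **Cell `(8, 8, 11)` of `m = 28` is empty, GIVEN coverage** —
`…InnerRankOfPeeled.false_of_rank_eight_le_twentyEight_of_peeled_eleven` with `HR2` supplied by
`HR2_eleven_of_coverage`. [folklore] -/
theorem false_of_rank_eight_le_twentyEight_of_coverage (K : Type*) [Field K] [CharZero K]
    (hcov : ∀ Φ : Matrix (Fin 4) (Fin 4) K,
      (¬ ∃ (a₀ a₁ y₀ y₁ : Fin 4 → K) (P₀₀ P₁₀ P₀₁ P₁₁ W₀ : Matrix (Fin 4) (Fin 4) K)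
        (v : Fin 4 → Fin 4 → K) (s : Fin 4 → K) (W : Matrix (Fin 4) (Fin 4) K),
        a₀ ⬝ᵥ Φ *ᵥ y₀ = 0 ∧ a₀ ⬝ᵥ Φ *ᵥ y₁ = 0 ∧ a₁ ⬝ᵥ Φ *ᵥ y₀ = 0 ∧ a₁ ⬝ᵥ Φ *ᵥ y₁ = 0 ∧
        (∀ b l, P₀₀ b l = (Matrix.of ![a₀, Pi.single b 1, y₀, Pi.single l 1]).permanent) ∧
        (∀ b l, P₁₀ b l = (Matrix.of ![a₀, Pi.single b 1, y₁, Pi.single l 1]).permanent) ∧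
        (∀ b l, P₀₁ b l = (Matrix.of ![a₁, Pi.single b 1, y₀, Pi.single l 1]).permanent) ∧
        (∀ b l, P₁₁ b l = (Matrix.of ![a₁, Pi.single b 1, y₁, Pi.single l 1]).permanent) ∧
        W₀ * P₀₀ = 1 ∧ (∀ j, P₁₀ *ᵥ v j = s j • P₀₀ *ᵥ v j) ∧ (∀ i j, i ≠ j → s i ≠ s j) ∧
        W * Matrix.of v = 1 ∧ P₁₁ - P₁₀ * W₀ * P₀₁ ≠ 0) →
      (¬ ∃ (a₀ a₁ y₀ y₁ : Fin 4 → K) (P₀₀ P₁₀ P₀₁ P₁₁ W₀ : Matrix (Fin 4) (Fin 4) K)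
        (v : Fin 4 → Fin 4 → K) (s : Fin 4 → K) (W : Matrix (Fin 4) (Fin 4) K),
        a₀ ⬝ᵥ Φᵀ *ᵥ y₀ = 0 ∧ a₀ ⬝ᵥ Φᵀ *ᵥ y₁ = 0 ∧ a₁ ⬝ᵥ Φᵀ *ᵥ y₀ = 0 ∧ a₁ ⬝ᵥ Φᵀ *ᵥ y₁ = 0 ∧
        (∀ b l, P₀₀ b l = (Matrix.of ![a₀, Pi.single b 1, y₀, Pi.single l 1]).permanent) ∧
        (∀ b l, P₁₀ b l = (Matrix.of ![a₀, Pi.single b 1, y₁, Pi.single l 1]).permanent) ∧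
        (∀ b l, P₀₁ b l = (Matrix.of ![a₁, Pi.single b 1, y₀, Pi.single l 1]).permanent) ∧
        (∀ b l, P₁₁ b l = (Matrix.of ![a₁, Pi.single b 1, y₁, Pi.single l 1]).permanent) ∧
        W₀ * P₀₀ = 1 ∧ (∀ j, P₁₀ *ᵥ v j = s j • P₀₀ *ᵥ v j) ∧ (∀ i j, i ≠ j → s i ≠ s j) ∧
        W * Matrix.of v = 1 ∧ P₁₁ - P₁₀ * W₀ * P₀₁ ≠ 0) →
      ∃ (i j : Fin 4) (u w : K), i ≠ j ∧ u ≠ 0 ∧ w ≠ 0 ∧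
        ∀ a x : Fin 4 → K, a ⬝ᵥ Φ *ᵥ x = u * a i * x j + w * a j * x i)
    {m : ℕ} (hm : m ≤ 28)
    {i₀ : Fin m} {D : Matrix {i // i ≠ i₀} {i // i ≠ i₀} K}
    {bL : (Fin 4 × Fin 4 → K) →ₗ[K] ({i // i ≠ i₀} → K)}
    {CL : (Fin 4 × Fin 4 → K) →ₗ[K] Matrix {i // i ≠ i₀} {i // i ≠ i₀} K} {κ₀ : K}
    (hD : IsUnit D.det) (hDs : Dᵀ = D) (hCs : ∀ z, (CL z)ᵀ = CL z) (hκ₀ : κ₀ ≠ 0)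
    (hi : ∀ z, bL z ⬝ᵥ D⁻¹ *ᵥ bL z = 0)
    (hii : ∀ z, bL z ⬝ᵥ (D⁻¹ * CL z * D⁻¹) *ᵥ bL z = 0)
    (hiii : ∀ z, D.det * (bL z ⬝ᵥ (D⁻¹ * CL z * D⁻¹ * CL z * D⁻¹) *ᵥ bL z) =
      -(κ₀ * eval z (perPoly (Fin 4) K)))
    (hV4 : ∀ x ∈ LinearMap.ker bL, ∀ r c : Fin 4,
      ((Matrix.of fun i j => x (i, j)).submatrix r.succAbove c.succAbove).permanent = 0)
    (hcard : Fintype.card {i // i ≠ i₀} + 1 = m)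
    (hrn : finrank K (LinearMap.range bL) + finrank K (LinearMap.ker bL) = 16)
    (h8 : finrank K (LinearMap.range bL) = 8) : False :=
  false_of_rank_eight_le_twentyEight_of_peeled_eleven K hm hD hDs hCs hκ₀ hi hii hiii hV4 hcard hrn
    (HR2_eleven_of_coverage K hcov) h8

end Summit.ValiantsHypothesis.ValiantsHypothesis.Theorems.SymPencilPerFourPeeledElevenOfCoverage

end
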